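import Mathlib
import Literature.NumberTheory.Sieve.Maynard2016CoupledBoxW
import HarnessLib

/-!
# Maynard (2016), Lemma 7: removing a trivial slot from the weighted coupled sum

Topic `Literature/NumberTheory/Sieve`; trunk AntSieve / parity (Maynard 2016 large-gaps ladder, named
fact `Literature.NumberTheory.Sieve.Maynard2016.Lemma7Tuple` of `Maynard2016Lemma7PerTuple.lean`).

J. Maynard, *Large gaps between primes*, Ann. of Math. (2) 183 (2016), 915–933 = arXiv:1408.5110,
§6, proof of Lemma 7: in the main term `S_i` (display before (6.32)) the moduli of slot `i` are all
`1` (`d_i = d'_i = e_i = e'_i = 1`, display (6.26)), so the `4k`-fold sum is really a sum over the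
`k − 1` remaining slots, with the point values `F_i(0) F'_i(0) G_i(0) G'_i(0)` factored out.  This file
provides the re-indexing for the coupled terms of `Maynard2016CoupledBoxW`: with
`extOne i u := (l ↦ if l = i then 1 else u l)` (extension by `1` at slot `i`) and the restricted coupling
sets `restrictPairs i i' M p := {(a,b) : (a,b) ∈ M p}` on `{l // l ≠ i} × {l // l ≠ i'}`,
* `sum_filter_lcmBox_eq_sum_extOne` — `Σ_{d ∈ [1,X]^ι, d_i = 1} g(d) = Σ_{u ∈ [1,X]^{ι∖i}} g(extOne i u)`;
* `coupledAdm_extOne_iff` — the summation condition `CoupledAdm W m M` of the extended tuples is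
  `CoupledAdm W m (restrictPairs i i' M)` of the restricted ones;
* `coupledLcmTermW_extOne` — the term factors as `F_i(0) F'_i(0) G_{i'}(0) G'_{i'}(0) ·` (the term of
  the restricted tuples).

## References

* J. Maynard, *Large gaps between primes*, Ann. of Math. (2) 183 (2016), 915–933; arXiv:1408.5110,
  §6, displays (6.26), (6.32). [Maynard2016LargeGaps]
-/

noncomputable section

open Finset
open scoped BigOperators ArithmeticFunction.Moebius Classical

namespace Literature.NumberTheory.Sieve

namespace LcmEuler

variable {ι κ : Type*} [Fintype ι] [DecidableEq ι] [Fintype κ] [DecidableEq κ]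

/-! ### Extension by `1` at a slot -/

/-- Extension of a tuple on `{l // l ≠ i}` to `ι` by the value `1` at slot `i`.
[cite: Maynard2016LargeGaps, §6 display (6.26)] -/
def extOne (i : ι) (u : {l : ι // l ≠ i} → ℕ) : ι → ℕ :=
  fun l => if h : l = i then 1 else u ⟨l, h⟩

omit [Fintype ι] in
/-- `extOne i u i = 1`. [folklore] -/
private theorem extOne_self (i : ι) (u : {l : ι // l ≠ i} → ℕ) : extOne i u i = 1 := by
  simp [extOne]

omit [Fintype ι] in
/-- `extOne i u l = u l` off the slot. [folklore] -/
private theorem extOne_of_ne (i : ι) (u : {l : ι // l ≠ i} → ℕ) {l : ι} (h : l ≠ i) :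
    extOne i u l = u ⟨l, h⟩ := by
  simp [extOne, h]

omit [Fintype ι] in
/-- `extOne i u l = u l` for `l : {l // l ≠ i}`. [folklore] -/
private theorem extOne_val (i : ι) (u : {l : ι // l ≠ i} → ℕ) (l : {l : ι // l ≠ i}) :
    extOne i u l.1 = u l := by
  rw [extOne_of_ne i u l.2]

/-- **Splitting a product over `ι` at the slot `i`** for extended tuples.
[cite: Maynard2016LargeGaps, §6 display (6.26)] -/
theorem prod_extOne {β : Type*} [CommMonoid β] (i : ι) (u u' : {l : ι // l ≠ i} → ℕ)
    (f : ι → ℕ → ℕ → β) :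
    ∏ l, f l (extOne i u l) (extOne i u' l) = f i 1 1 * ∏ l : {l : ι // l ≠ i}, f l.1 (u l) (u' l) := by
  rw [← Finset.mul_prod_erase Finset.univ _ (Finset.mem_univ i), extOne_self, extOne_self]
  congr 1
  rw [Finset.prod_subtype (Finset.univ.erase i) (p := fun l => l ≠ i)
    (fun l => by simp [Finset.mem_erase])]
  exact Finset.prod_congr rfl fun l _ => by rw [extOne_val, extOne_val]

/-- **Re-indexing the box with a trivial slot**: for `1 ≤ X`,
`Σ_{d ∈ [1,X]^ι, d_i = 1} g(d) = Σ_{u ∈ [1,X]^{ι∖i}} g(extOne i u)`.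
[cite: Maynard2016LargeGaps, §6 display (6.26)] -/
theorem sum_filter_lcmBox_eq_sum_extOne {β : Type*} [AddCommMonoid β] (i : ι) {X : ℕ} (hX : 1 ≤ X)
    (g : (ι → ℕ) → β) :
    ∑ d ∈ (lcmBox ι X).filter (fun d => d i = 1), g d =
      ∑ u ∈ lcmBox {l : ι // l ≠ i} X, g (extOne i u) := by
  refine Finset.sum_bij' (fun d _ => fun l => d l.1) (fun u _ => extOne i u) ?_ ?_ ?_ ?_ ?_
  · intro d hd
    simp only [Finset.mem_filter, lcmBox, Fintype.mem_piFinset] at hd ⊢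
    exact fun l => hd.1 l.1
  · intro u hu
    simp only [Finset.mem_filter, lcmBox, Fintype.mem_piFinset] at hu ⊢
    refine ⟨fun l => ?_, extOne_self i u⟩
    by_cases h : l = i
    · subst h; rw [extOne_self]; exact Finset.mem_Icc.2 ⟨le_rfl, hX⟩
    · rw [extOne_of_ne i u h]; exact hu _
  · intro d hd
    simp only [Finset.mem_filter] at hd
    funext l
    by_cases h : l = i
    · subst h; rw [extOne_self, hd.2]
    · rw [extOne_of_ne i _ h]
  · intro u hu
    funext l
    exact extOne_val i u l
  · intro d hd
    simp only [Finset.mem_filter] at hd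
    congr 1
    funext l
    by_cases h : l = i
    · subst h; rw [extOne_self, hd.2]
    · rw [extOne_of_ne i _ h]

/-! ### The summation condition -/

/-- The coupling sets restricted to the non-trivial slots. [cite: Maynard2016LargeGaps, §6 display (6.32)] -/
def restrictPairs (i : ι) (i' : κ) (M : ℕ → Finset (ι × κ)) (p : ℕ) :
    Finset ({l : ι // l ≠ i} × {l : κ // l ≠ i'}) :=
  Finset.univ.filter (fun ab => (ab.1.1, ab.2.1) ∈ M p)

omit [Fintype ι] in
/-- `lcm` of the extended pair off the slot. [folklore] -/
private theorem lcm_extOne_of_ne (i : ι) (u u' : {l : ι // l ≠ i} → ℕ) {l : ι} (h : l ≠ i) :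
    Nat.lcm (extOne i u l) (extOne i u' l) = Nat.lcm (u ⟨l, h⟩) (u' ⟨l, h⟩) := by
  rw [extOne_of_ne i u h, extOne_of_ne i u' h]

omit [Fintype ι] in
/-- `lcm` of the extended pair at the slot is `1`. [folklore] -/
private theorem lcm_extOne_self (i : ι) (u u' : {l : ι // l ≠ i} → ℕ) :
    Nat.lcm (extOne i u i) (extOne i u' i) = 1 := by
  rw [extOne_self, extOne_self, Nat.lcm_self]

omit [Fintype ι] in
/-- `LcmCoprime` is unchanged by a trivial slot. [folklore] -/
private theorem lcmCoprime_extOne_iff (W : ℕ) (i : ι) (u u' : {l : ι // l ≠ i} → ℕ) :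
    LcmCoprime W (extOne i u) (extOne i u') ↔ LcmCoprime W u u' := by
  constructor
  · rintro ⟨h1, h2⟩
    refine ⟨fun a b hab => ?_, fun a => ?_⟩
    · have h := h1 a.1 b.1 (fun e => hab (Subtype.ext e))
      rwa [lcm_extOne_of_ne i u u' a.2, lcm_extOne_of_ne i u u' b.2] at h
    · have h := h2 a.1
      rwa [lcm_extOne_of_ne i u u' a.2] at h
  · rintro ⟨h1, h2⟩
    refine ⟨fun a b hab => ?_, fun a => ?_⟩
    · by_cases ha : a = i
      · subst ha; rw [lcm_extOne_self]; exact Nat.coprime_one_left _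
      by_cases hb : b = i
      · subst hb; rw [lcm_extOne_self]; exact Nat.coprime_one_right _
      rw [lcm_extOne_of_ne i u u' ha, lcm_extOne_of_ne i u u' hb]
      exact h1 ⟨a, ha⟩ ⟨b, hb⟩ (fun e => hab (congrArg Subtype.val e))
    · by_cases ha : a = i
      · subst ha; rw [lcm_extOne_self]; exact Nat.coprime_one_left _
      rw [lcm_extOne_of_ne i u u' ha]
      exact h2 ⟨a, ha⟩

/-- **The coupled summation condition is unchanged by trivial slots**:
`CoupledAdm W m M (extOne i u, extOne i u') (extOne i' v, extOne i' v') ↔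
CoupledAdm W m (restrictPairs i i' M) (u,u') (v,v')`. [cite: Maynard2016LargeGaps, §6 displays (6.26), (6.32)] -/
theorem coupledAdm_extOne_iff (W m : ℕ) (M : ℕ → Finset (ι × κ)) (i : ι) (i' : κ)
    (u u' : {l : ι // l ≠ i} → ℕ) (v v' : {l : κ // l ≠ i'} → ℕ) :
    CoupledAdm W m M (extOne i u, extOne i u') (extOne i' v, extOne i' v') ↔
      CoupledAdm W m (restrictPairs i i' M) (u, u') (v, v') := by
  unfold CoupledAdm
  simp only
  rw [lcmCoprime_extOne_iff, lcmCoprime_extOne_iff]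
  refine and_congr Iff.rfl (and_congr Iff.rfl (and_congr ?_ ?_))
  · constructor
    · intro h b
      have hb := h b.1
      rwa [lcm_extOne_of_ne i' v v' b.2] at hb
    · intro h b
      by_cases hb : b = i'
      · subst hb; rw [lcm_extOne_self]; exact Nat.coprime_one_left _
      rw [lcm_extOne_of_ne i' v v' hb]
      exact h ⟨b, hb⟩
  · constructor
    · intro h p hp a b ha hb
      have h' := h p hp a.1 b.1 (by rwa [lcm_extOne_of_ne i u u' a.2])
        (by rwa [lcm_extOne_of_ne i' v v' b.2])
      simpa [restrictPairs] using h'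
    · intro h p hp a b ha hb
      by_cases hai : a = i
      · subst hai
        rw [lcm_extOne_self, Nat.dvd_one] at ha
        exact absurd ha hp.one_lt.ne'
      by_cases hbi : b = i'
      · subst hbi
        rw [lcm_extOne_self, Nat.dvd_one] at hb
        exact absurd hb hp.one_lt.ne'
      rw [lcm_extOne_of_ne i u u' hai] at ha
      rw [lcm_extOne_of_ne i' v v' hbi] at hb
      have h' := h p hp ⟨a, hai⟩ ⟨b, hbi⟩ ha hb
      simpa [restrictPairs] using h'

/-! ### The term -/

/-- **The weighted coupled term of tuples with a trivial slot** factors as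
`F_i(0) F'_i(0) G_{i'}(0) G'_{i'}(0) ·` (the term of the restricted tuples) (`μ(1) = 1`, `log 1 = 0`,
`[1,1] = 1`). [cite: Maynard2016LargeGaps, §6 displays (6.26), (6.32)] -/
theorem coupledLcmTermW_extOne (w : ℕ → ℂ) (F F' : ι → ℝ → ℝ) (G G' : κ → ℝ → ℝ) (x y : ℝ)
    (i : ι) (i' : κ) (u u' : {l : ι // l ≠ i} → ℕ) (v v' : {l : κ // l ≠ i'} → ℕ) :
    coupledLcmTermW w F F' G G' x y (extOne i u, extOne i u') (extOne i' v, extOne i' v') =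
      (F i 0 : ℂ) * F' i 0 * G i' 0 * G' i' 0 *
        coupledLcmTermW w (fun l => F l.1) (fun l => F' l.1) (fun l => G l.1) (fun l => G' l.1) x y
          (u, u') (v, v') := by
  unfold coupledLcmTermW
  simp only
  rw [prod_extOne i u u' (fun l n n' => (μ n : ℂ) * μ n' * F l (Real.log n / Real.log x) *
      F' l (Real.log n' / Real.log x)),
    prod_extOne i' v v' (fun l n n' => (μ n : ℂ) * μ n' * G l (Real.log n / Real.log y) *
      G' l (Real.log n' / Real.log y)),
    prod_extOne i u u' (fun _ n n' => Nat.lcm n n'), prod_extOne i' v v' (fun _ n n' => Nat.lcm n n')]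
  simp only [Nat.lcm_self, one_mul, ArithmeticFunction.moebius_apply_one, Int.cast_one, Nat.cast_one,
    Real.log_one, zero_div]
  ring

end LcmEuler

end Literature.NumberTheory.Sieve

end
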